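import Literature.Probability.LatticeModels.IsingLimitLawLeeYangProofs
import Literature.Analysis.Complex.Hurwitz
import Mathlib.Probability.Moments.ComplexMGF
import Mathlib.MeasureTheory.Measure.Portmanteau
import Mathlib.Topology.UniformSpace.Ascoli
import Mathlib.Analysis.Complex.Convex
import HarnessLib

/-!
# Lee–Yang is closed under Ising limits: discharge of `hasLeeYangProperty_of_isIsingLimitLaw`

Sibling proof file of `Literature.Probability.LatticeModels.IsingLimitLaw` (which holds the D-0014
named facts and is review-gated; proofs live in siblings, and this file declares no definition),
next to `IsingLimitLawProofs.lean` (GHS), `IsingLimitLawPhi4Proofs.lean` (Simon–Griffiths) and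
`IsingLimitLawLeeYangProofs.lean` (`lee_yang_ising_holds`, zero weights allowed). It discharges

* `hasLeeYangProperty_of_isIsingLimitLaw` (Newman 1974, Thm. 3: the Lee–Yang property passes to
  weak limits of ferromagnetic Ising magnetization laws with uniformly bounded `e^{bu²}`-moments)
  as `hasLeeYangProperty_of_isIsingLimitLaw_holds`,

from the tree THEOREMS `lee_yang_ising_holds` (the approximants are zero-free off the imaginary
axis) and `Complex.hurwitz_eqOn_zero_or_forall_ne_zero` (`Literature.Analysis.Complex.Hurwitz`).

## Proof architecture (namespace `Literature.Probability.LatticeModels.LeeYangLimit`)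

Let `μ_k → ν` weakly with `sup_k ∫ e^{u²} dμ_k ≤ C₁`, `F_k(z) = ∫ e^{zu} dμ_k`,
`f(z) = ∫ e^{zu} dν`.
1. `e^{a|u|} ≤ e^{a²/4} e^{u²}` (`exp_mul_abs_le`), so `∫ e^{a|u|} dμ_k ≤ e^{a²/4} C₁` for all
   `a, k`; every continuous function is `μ_k`-integrable (`integrable_isingMagnetizationLaw`,
   finitely supported laws), so the hypothesis' Bochner integrals are honest.
2. Transfer to the limit (`integrable_of_tendsto_of_integral_le`): portmanteau for open sets
   (`ProbabilityMeasure.le_liminf_measure_open_of_tendsto`) and Mathlib's layer-cake Fatou lemma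
   `lintegral_le_liminf_lintegral_of_forall_isOpen_measure_le_liminf_measure` give
   `∫ e^{a|u|} dν ≤ e^{a²/4} C₁`; hence `f` is entire (Mathlib `complexMGF`,
   `differentiable_integral_cexp`) and `f(x) > 0` for real `x` (`mgf_pos`).
3. Pointwise convergence `F_k(z) → f(z)` (`tendsto_integral_cexp_of_tendsto`): the truncation
   `g_M(u) = e^{z·clamp_M(u)}` is bounded continuous (weak convergence,
   `ProbabilityMeasure.tendsto_iff_forall_integral_rclike_tendsto`), and the tails obey
   `‖e^{zu} - g_M(u)‖ ≤ 2e^{-M} e^{(‖z‖+1)|u|}` (`norm_cexp_sub_cexp_clamp_le`).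
4. Equi-Lipschitz bounds on discs from the mean value inequality for `ζ ↦ e^{ζu}`
   (`norm_cexp_sub_cexp_le`), and Arzelà–Ascoli in the form
   `EquicontinuousOn.tendsto_uniformOnFun_iff_pi` upgrade pointwise to locally uniform convergence
   (`tendstoLocallyUniformly_of_lipschitzOnWith`).
5. `F_k` is entire and zero-free off the imaginary axis (`integral_exp_isingMagnetizationLaw`,
   `lee_yang_ising_holds`); Hurwitz on each open half plane, `f(±1) ≠ 0` excluding `f ≡ 0`.
This is the printed route of Lieb–Sokal 1981, §2: Lemma 2.8 (p. 163: the Laplace transform is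
sequentially continuous from measures with Gaussian falloff, weak topology, into entire functions
with locally uniform convergence) and the remark before Prop. 2.6 (p. 161: by Hurwitz's theorem a
limit of functions zero-free on `A` is `≡ 0` or zero-free on the interior of `A`); Newman 1974,
Thm. 3 is the statement vendored in `IsingLimitLaw.lean` (paper not held locally).

## References

* C. M. Newman, *Zeros of the partition function for generalized Ising systems*, Comm. Pure Appl.
  Math. 27 (1974), 143–159, Thm. 3. [Newman1974] (doi:10.1002/cpa.3160270203; not held
  locally — the statement discharged is the tree's vendored form in `IsingLimitLaw.lean`)
* E. H. Lieb, A. D. Sokal, *A general Lee–Yang theorem for one-component and multicomponent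
  ferromagnets*, Comm. Math. Phys. 80 (1981), 153–179, §2: remark before Prop. 2.6 (p. 161),
  Lemma 2.8 (p. 163); §3, Def. 3.1 (read in E. H. Lieb, *Statistical Mechanics. Selecta*,
  Springer 2004, reprint pp. 153–179). [LiebSokal1981]
* J. B. Conway, *Functions of one complex variable I*, 2nd ed., Ch. VII, Thm. 2.5 (Hurwitz).
  [Conway1978]

## Mathlib / tree anchors

`ProbabilityTheory.analyticAt_complexMGF`, `ProbabilityTheory.mgf_pos`,
`MeasureTheory.ProbabilityMeasure.tendsto_iff_forall_integral_rclike_tendsto`,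
`MeasureTheory.lintegral_le_liminf_lintegral_of_forall_isOpen_measure_le_liminf_measure`,
`EquicontinuousOn.tendsto_uniformOnFun_iff_pi`, `LipschitzOnWith.uniformEquicontinuousOn`,
`Convex.norm_image_sub_le_of_norm_hasDerivWithin_le`; tree: `lee_yang_ising_holds`
(`IsingLimitLawLeeYangProofs`), `integral_exp_isingMagnetizationLaw` (`IsingLimitLaw`),
`Complex.hurwitz_eqOn_zero_or_forall_ne_zero` (`Literature.Analysis.Complex.Hurwitz`).
This file declares no definition.
-/

noncomputable section

open MeasureTheory Filter Topology Metric Set ProbabilityTheory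
open scoped ENNReal NNReal BoundedContinuousFunction

namespace Literature.Probability.LatticeModels

namespace LeeYangLimit

/-! ### Finite Ising laws integrate everything -/

/-- Every continuous function is integrable against a finite Ising magnetization law (a finitely
supported measure). [folklore] -/
theorem integrable_isingMagnetizationLaw {n : ℕ} (J : Fin n → Fin n → ℝ) (w : Fin n → ℝ)
    {E : Type*} [NormedAddCommGroup E] {g : ℝ → E} (hg : Continuous g) :
    Integrable g (isingMagnetizationLaw n J w : Measure ℝ) := by
  change Integrable g ((isingPairPMF J).map (weightedMagnetization w)).toMeasure
  rw [← PMF.toMeasure_map (weightedMagnetization w) (isingPairPMF J) (measurable_of_config _)]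
  exact (integrable_map_measure hg.aestronglyMeasurable
    (measurable_of_config _).aemeasurable).2 Integrable.of_finite

/-! ### Elementary exponential bounds -/

/-- `e^{a|u|} ≤ e^{a²/4} e^{u²}` (from `(|u| - a/2)² ≥ 0`). [folklore] -/
theorem exp_mul_abs_le (a u : ℝ) :
    Real.exp (a * |u|) ≤ Real.exp (a ^ 2 / 4) * Real.exp (1 * u ^ 2) := by
  rw [← Real.exp_add]
  refine Real.exp_le_exp.2 ?_
  nlinarith [sq_nonneg (|u| - a / 2), sq_abs u]

/-- `‖e^{zu}‖ ≤ e^{a|u|}` when `‖z‖ ≤ a`. [folklore] -/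
theorem norm_cexp_mul_le {z : ℂ} {a : ℝ} (hz : ‖z‖ ≤ a) (u : ℝ) :
    ‖Complex.exp (z * u)‖ ≤ Real.exp (a * |u|) := by
  rw [Complex.norm_exp, Real.exp_le_exp, Complex.re_mul_ofReal]
  calc z.re * u ≤ |z.re * u| := le_abs_self _
    _ = |z.re| * |u| := abs_mul _ _
    _ ≤ a * |u| := by
      gcongr
      exact (Complex.abs_re_le_norm z).trans hz

/-- Mean-value estimate `‖e^{zu} - e^{z'u}‖ ≤ ‖z - z'‖ e^{(R+1)|u|}` on the disc `‖·‖ ≤ R`.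
[folklore] -/
theorem norm_cexp_sub_cexp_le {R : ℝ} {z z' : ℂ} (hz : z ∈ closedBall (0 : ℂ) R)
    (hz' : z' ∈ closedBall (0 : ℂ) R) (u : ℝ) :
    ‖Complex.exp (z * u) - Complex.exp (z' * u)‖ ≤ Real.exp ((R + 1) * |u|) * ‖z - z'‖ := by
  have hderiv : ∀ ζ ∈ closedBall (0 : ℂ) R, HasDerivWithinAt (fun ζ : ℂ => Complex.exp (ζ * u))
      (Complex.exp (ζ * u) * u) (closedBall (0 : ℂ) R) ζ :=
    fun ζ _ => ((hasDerivAt_mul_const (u : ℂ)).cexp).hasDerivWithinAt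
  have hbound : ∀ ζ ∈ closedBall (0 : ℂ) R,
      ‖Complex.exp (ζ * u) * u‖ ≤ Real.exp ((R + 1) * |u|) := by
    intro ζ hζ
    rw [norm_mul, Complex.norm_real, Real.norm_eq_abs, add_mul, Real.exp_add, one_mul]
    gcongr
    · exact norm_cexp_mul_le (mem_closedBall_zero_iff.1 hζ) u
    · linarith [Real.add_one_le_exp |u|]
  exact (convex_closedBall (0 : ℂ) R).norm_image_sub_le_of_norm_hasDerivWithin_le hderiv hbound
    hz' hz

/-- Truncation `u ↦ max (-M) (min M u)`. [folklore] -/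
theorem abs_clamp_le (M u : ℝ) (hM : 0 ≤ M) :
    |max (-M) (min M u)| ≤ |u| ∧ |max (-M) (min M u)| ≤ M := by
  constructor
  · rcases le_total u M with h | h
    · rw [min_eq_right h]
      rcases le_total (-M) u with h' | h'
      · rw [max_eq_right h']
      · rw [max_eq_left h', abs_of_nonpos (by linarith)]
        have : u ≤ 0 := by linarith
        rw [abs_of_nonpos this]; linarith
    · rw [min_eq_left h, max_eq_right (by linarith), abs_of_nonneg hM]
      exact le_trans h (le_abs_self u)
  · exact abs_le.2 ⟨le_max_left _ _, max_le (by linarith) (min_le_left _ _)⟩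

/-- Tail estimate for the truncated exponential:
`‖e^{zu} - e^{z clamp_M(u)}‖ ≤ 2 e^{-M} e^{a|u|}` when `‖z‖ + 1 ≤ a`. [folklore] -/
theorem norm_cexp_sub_cexp_clamp_le {z : ℂ} {a M : ℝ} (hz : ‖z‖ + 1 ≤ a) (hM : 0 ≤ M) (u : ℝ) :
    ‖Complex.exp (z * u) - Complex.exp (z * (max (-M) (min M u) : ℝ))‖ ≤
      2 * Real.exp (-M) * Real.exp (a * |u|) := by
  by_cases hu : |u| ≤ M
  · have : max (-M) (min M u) = u := by
      rw [abs_le] at hu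
      rw [min_eq_right hu.2, max_eq_right hu.1]
    rw [this, sub_self, norm_zero]
    positivity
  · push Not at hu
    have h1 : ‖Complex.exp (z * u)‖ ≤ Real.exp (‖z‖ * |u|) := norm_cexp_mul_le le_rfl u
    have h2 : ‖Complex.exp (z * (max (-M) (min M u) : ℝ))‖ ≤ Real.exp (‖z‖ * |u|) := by
      refine (norm_cexp_mul_le le_rfl _).trans (Real.exp_le_exp.2 ?_)
      exact mul_le_mul_of_nonneg_left (abs_clamp_le M u hM).1 (norm_nonneg _)
    have h3 : Real.exp (‖z‖ * |u|) ≤ Real.exp (-M) * Real.exp (a * |u|) := by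
      rw [← Real.exp_add, Real.exp_le_exp]
      nlinarith [abs_nonneg u, norm_nonneg z]
    calc ‖Complex.exp (z * u) - Complex.exp (z * (max (-M) (min M u) : ℝ))‖
        ≤ ‖Complex.exp (z * u)‖ + ‖Complex.exp (z * (max (-M) (min M u) : ℝ))‖ := norm_sub_le _ _
      _ ≤ Real.exp (‖z‖ * |u|) + Real.exp (‖z‖ * |u|) := add_le_add h1 h2
      _ ≤ 2 * Real.exp (-M) * Real.exp (a * |u|) := by linarith

/-! ### Laplace transforms of measures with all exponential moments -/

/-- If all `e^{tu}` are `μ`-integrable, the Laplace transform `z ↦ ∫ e^{zu} dμ` is entire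
(Mathlib's `complexMGF` of `id`). [folklore] -/
theorem differentiable_integral_cexp {μ : Measure ℝ}
    (h : ∀ t : ℝ, Integrable (fun u => Real.exp (t * u)) μ) :
    Differentiable ℂ fun z : ℂ => ∫ u, Complex.exp (z * u) ∂μ := by
  have hset : integrableExpSet id μ = univ := eq_univ_of_forall fun t => h t
  intro z
  have hz : z.re ∈ interior (integrableExpSet id μ) := by simp [hset]
  exact (analyticAt_complexMGF hz).differentiableAt

/-- `e^{a|u|}`-integrability gives integrability of `e^{zu}` for `‖z‖ ≤ a`. [folklore] -/
theorem integrable_cexp_mul_of_norm_le {μ : Measure ℝ} {a : ℝ}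
    (h : Integrable (fun u => Real.exp (a * |u|)) μ) {z : ℂ} (hz : ‖z‖ ≤ a) :
    Integrable (fun u : ℝ => Complex.exp (z * u)) μ :=
  h.mono' (by fun_prop) (Eventually.of_forall fun u => norm_cexp_mul_le hz u)

/-- `e^{a|u|}`-integrability gives integrability of `e^{tu}` for `|t| ≤ a`. [folklore] -/
theorem integrable_exp_mul_of_abs_le {μ : Measure ℝ} {a : ℝ}
    (h : Integrable (fun u => Real.exp (a * |u|)) μ) {t : ℝ} (ht : |t| ≤ a) :
    Integrable (fun u : ℝ => Real.exp (t * u)) μ := by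
  refine h.mono' (by fun_prop) (Eventually.of_forall fun u => ?_)
  rw [Real.norm_eq_abs, Real.abs_exp, Real.exp_le_exp]
  calc t * u ≤ |t * u| := le_abs_self _
    _ = |t| * |u| := abs_mul _ _
    _ ≤ a * |u| := by gcongr

/-! ### Weak limits: transfer of moment bounds and convergence of Laplace transforms -/

/-- **Fatou along a weak limit**: a continuous `h ≥ 0` with `∫ h dμ_k ≤ D` along a weakly
convergent sequence of probability measures is integrable for the limit, with `∫ h dν ≤ D`
(portmanteau for open sets + layer-cake Fatou). [folklore] -/
theorem integrable_of_tendsto_of_integral_le {μs : ℕ → ProbabilityMeasure ℝ}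
    {ν : ProbabilityMeasure ℝ} (hlim : Tendsto μs atTop (𝓝 ν)) {h : ℝ → ℝ} (hc : Continuous h)
    (h0 : ∀ u, 0 ≤ h u) {D : ℝ} (hint : ∀ k, Integrable h (μs k : Measure ℝ))
    (hD : ∀ k, ∫ u, h u ∂(μs k : Measure ℝ) ≤ D) :
    Integrable h (ν : Measure ℝ) ∧ ∫ u, h u ∂(ν : Measure ℝ) ≤ D := by
  have hopen : ∀ G : Set ℝ, IsOpen G →
      (ν : Measure ℝ) G ≤ atTop.liminf fun k => (μs k : Measure ℝ) G :=
    fun G hG => ProbabilityMeasure.le_liminf_measure_open_of_tendsto hlim hG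
  have hlint : ∫⁻ u, ENNReal.ofReal (h u) ∂(ν : Measure ℝ) ≤ ENNReal.ofReal D := by
    refine (lintegral_le_liminf_lintegral_of_forall_isOpen_measure_le_liminf_measure hc h0
      hopen).trans
      (Filter.liminf_le_of_frequently_le' (Eventually.of_forall fun k => ?_).frequently)
    rw [← ofReal_integral_eq_lintegral_ofReal (hint k) (Eventually.of_forall h0)]
    exact ENNReal.ofReal_le_ofReal (hD k)
  have hD0 : 0 ≤ D := (integral_nonneg h0).trans (hD 0)
  have hi : Integrable h (ν : Measure ℝ) := by
    refine ⟨hc.aestronglyMeasurable, ?_⟩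
    rw [hasFiniteIntegral_iff_ofReal (Eventually.of_forall h0)]
    exact hlint.trans_lt ENNReal.ofReal_lt_top
  refine ⟨hi, ?_⟩
  rw [integral_eq_lintegral_of_nonneg_ae (Eventually.of_forall h0) hc.aestronglyMeasurable]
  exact ENNReal.toReal_le_of_le_ofReal hD0 hlint

/-- **Laplace transforms converge pointwise along a weak limit with uniform exponential
moments**: truncate `e^{zu}` at `|u| ≤ M` (bounded continuous, handled by weak convergence) and
bound both tails by `2e^{-M} ∫ e^{a|u|}`. [Newman 1974, proof of Thm. 3] [folklore] -/
theorem tendsto_integral_cexp_of_tendsto {μs : ℕ → ProbabilityMeasure ℝ}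
    {ν : ProbabilityMeasure ℝ} (hlim : Tendsto μs atTop (𝓝 ν)) {a D : ℝ}
    (hks : ∀ k, Integrable (fun u => Real.exp (a * |u|)) (μs k : Measure ℝ))
    (hkD : ∀ k, ∫ u, Real.exp (a * |u|) ∂(μs k : Measure ℝ) ≤ D)
    (hνi : Integrable (fun u => Real.exp (a * |u|)) (ν : Measure ℝ))
    (hνD : ∫ u, Real.exp (a * |u|) ∂(ν : Measure ℝ) ≤ D) {z : ℂ} (hz : ‖z‖ + 1 ≤ a) :
    Tendsto (fun k => ∫ u, Complex.exp (z * u) ∂(μs k : Measure ℝ)) atTop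
      (𝓝 (∫ u, Complex.exp (z * u) ∂(ν : Measure ℝ))) := by
  have hz0 : ‖z‖ ≤ a := by linarith [norm_nonneg z]
  have hD0 : 0 ≤ D := (integral_nonneg fun u => (Real.exp_pos _).le).trans hνD
  -- tail estimate, for any of the measures involved
  have tail : ∀ (ρ : Measure ℝ) [IsProbabilityMeasure ρ],
      Integrable (fun u => Real.exp (a * |u|)) ρ → ∫ u, Real.exp (a * |u|) ∂ρ ≤ D →
      ∀ {M : ℝ}, 0 ≤ M → ∀ g : ℝ →ᵇ ℂ,
        (∀ u, g u = Complex.exp (z * (max (-M) (min M u) : ℝ))) →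
        ‖(∫ u, Complex.exp (z * u) ∂ρ) - ∫ u, g u ∂ρ‖ ≤ 2 * Real.exp (-M) * D := by
    intro ρ _ hρi hρD M hM g hg
    rw [← integral_sub (integrable_cexp_mul_of_norm_le hρi hz0) (g.integrable ρ)]
    calc ‖∫ u, Complex.exp (z * u) - g u ∂ρ‖
        ≤ ∫ u, 2 * Real.exp (-M) * Real.exp (a * |u|) ∂ρ := by
          refine norm_integral_le_of_norm_le (hρi.const_mul _) (Eventually.of_forall fun u => ?_)
          rw [hg u]
          exact norm_cexp_sub_cexp_clamp_le hz hM u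
      _ = 2 * Real.exp (-M) * ∫ u, Real.exp (a * |u|) ∂ρ := integral_const_mul _ _
      _ ≤ 2 * Real.exp (-M) * D := by gcongr
  rw [Metric.tendsto_nhds]
  intro ε hε
  -- choose the truncation level
  obtain ⟨M, hM0, hM⟩ : ∃ M : ℝ, 0 ≤ M ∧ 2 * Real.exp (-M) * D < ε / 3 := by
    have h1 : Tendsto (fun M : ℝ => 2 * Real.exp (-M) * D) atTop (𝓝 (2 * 0 * D)) :=
      (Real.tendsto_exp_neg_atTop_nhds_zero.const_mul 2).mul_const D
    rw [mul_zero, zero_mul] at h1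
    obtain ⟨M, hM⟩ := ((h1.eventually (gt_mem_nhds (by positivity : (0 : ℝ) < ε / 3))).and
      (eventually_ge_atTop 0)).exists
    exact ⟨M, hM.2, hM.1⟩
  -- the truncated integrand as a bounded continuous function
  set g : ℝ →ᵇ ℂ := BoundedContinuousFunction.ofNormedAddCommGroup
    (fun u : ℝ => Complex.exp (z * (max (-M) (min M u) : ℝ))) (by fun_prop) (Real.exp (a * M))
    (fun u => (norm_cexp_mul_le hz0 _).trans (Real.exp_le_exp.2
      (mul_le_mul_of_nonneg_left (abs_clamp_le M u hM0).2
        (by linarith [norm_nonneg z])))) with hgdef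
  have hg : ∀ u, g u = Complex.exp (z * (max (-M) (min M u) : ℝ)) := fun u => rfl
  have hweak := (ProbabilityMeasure.tendsto_iff_forall_integral_rclike_tendsto ℂ).1 hlim g
  rw [Metric.tendsto_nhds] at hweak
  filter_upwards [hweak (ε / 3) (by positivity)] with k hk
  calc dist (∫ u, Complex.exp (z * u) ∂(μs k : Measure ℝ))
        (∫ u, Complex.exp (z * u) ∂(ν : Measure ℝ))
      ≤ dist (∫ u, Complex.exp (z * u) ∂(μs k : Measure ℝ)) (∫ u, g u ∂(μs k : Measure ℝ)) +
          dist (∫ u, g u ∂(μs k : Measure ℝ)) (∫ u, g u ∂(ν : Measure ℝ)) +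
          dist (∫ u, g u ∂(ν : Measure ℝ)) (∫ u, Complex.exp (z * u) ∂(ν : Measure ℝ)) :=
        dist_triangle4 _ _ _ _
    _ < ε / 3 + ε / 3 + ε / 3 := by
        gcongr
        · rw [dist_eq_norm]
          exact (tail _ (hks k) (hkD k) hM0 g hg).trans_lt hM
        · rw [dist_comm, dist_eq_norm]
          exact (tail _ hνi hνD hM0 g hg).trans_lt hM
    _ = ε := by ring

/-- **Equi-Lipschitz + pointwise convergence ⇒ locally uniform convergence** (Arzelà–Ascoli,
Mathlib's `EquicontinuousOn.tendsto_uniformOnFun_iff_pi`). [folklore] -/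
theorem tendstoLocallyUniformly_of_lipschitzOnWith {F : ℕ → ℂ → ℂ} {f : ℂ → ℂ}
    (hpt : ∀ z, Tendsto (fun k => F k z) atTop (𝓝 (f z)))
    (hlip : ∀ R : ℝ, ∃ L : ℝ≥0, ∀ k, LipschitzOnWith L (F k) (closedBall 0 R)) :
    TendstoLocallyUniformly F f atTop := by
  have hpi : Tendsto F atTop (𝓝 f) := tendsto_pi_nhds.2 hpt
  set 𝔖 : Set (Set ℂ) := {K | IsCompact K} with h𝔖
  have h1 : ∀ K ∈ 𝔖, IsCompact K := fun K hK => hK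
  have h2 : ⋃₀ 𝔖 = univ :=
    eq_univ_of_forall fun z => ⟨{z}, isCompact_singleton, mem_singleton z⟩
  have h3 : ∀ K ∈ 𝔖, EquicontinuousOn F K := fun K hK => by
    obtain ⟨R, hR⟩ := (Metric.isBounded_iff_subset_closedBall 0).1 (h1 K hK).isBounded
    obtain ⟨L, hL⟩ := hlip R
    exact (LipschitzOnWith.uniformEquicontinuousOn F L hL).equicontinuousOn.mono hR
  have h4 := (EquicontinuousOn.tendsto_uniformOnFun_iff_pi h1 h2 h3 atTop f).2 hpi
  rw [UniformOnFun.tendsto_iff_tendstoUniformlyOn] at h4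
  rw [tendstoLocallyUniformly_iff_forall_isCompact]
  intro K hK
  exact h4 K hK

end LeeYangLimit

open LeeYangLimit in
/-- **Discharge of `hasLeeYangProperty_of_isIsingLimitLaw`** (Lee–Yang is closed under Ising
limits): a weak limit `ν` of ferromagnetic Ising magnetization laws with uniformly bounded
`e^{bu²}`-moments has all zeros of `z ↦ ∫ e^{zu} dν` on the imaginary axis. Locally uniform
convergence of the entire Laplace transforms (uniform exponential moments, truncation,
Arzelà–Ascoli) and Hurwitz's theorem on each open half plane, the approximants being zero-free
there by `lee_yang_ising_holds` and the limit being positive at `±1`.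
[Newman 1974, Thm. 3; Lieb–Sokal 1981, §2] [cite: Newman1974, Thm. 3] -/
theorem hasLeeYangProperty_of_isIsingLimitLaw_holds : hasLeeYangProperty_of_isIsingLimitLaw := by
  rintro ν ⟨n, J, w, hJ, hw, hlim, hbd⟩
  set μs : ℕ → ProbabilityMeasure ℝ := fun k => isingMagnetizationLaw (n k) (J k) (w k) with hμs
  obtain ⟨C₁, hC₁⟩ := hbd 1
  have hint : ∀ k, ∀ {g : ℝ → ℝ}, Continuous g → Integrable g (μs k : Measure ℝ) :=
    fun k g hg => integrable_isingMagnetizationLaw _ _ hg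
  -- (1) uniform exponential-moment bounds along the sequence
  have hks : ∀ a k, Integrable (fun u => Real.exp (a * |u|)) (μs k : Measure ℝ) :=
    fun a k => hint k (by fun_prop)
  have hkD : ∀ a k, ∫ u, Real.exp (a * |u|) ∂(μs k : Measure ℝ) ≤ Real.exp (a ^ 2 / 4) * C₁ := by
    intro a k
    calc ∫ u, Real.exp (a * |u|) ∂(μs k : Measure ℝ)
        ≤ ∫ u, Real.exp (a ^ 2 / 4) * Real.exp (1 * u ^ 2) ∂(μs k : Measure ℝ) :=
          integral_mono (hks a k) ((hint k (by fun_prop)).const_mul _) fun u => exp_mul_abs_le a u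
      _ = Real.exp (a ^ 2 / 4) * ∫ u, Real.exp (1 * u ^ 2) ∂(μs k : Measure ℝ) :=
          integral_const_mul _ _
      _ ≤ Real.exp (a ^ 2 / 4) * C₁ := by gcongr; exact hC₁ k
  -- (2) transfer to the limit law
  have hν : ∀ a, Integrable (fun u => Real.exp (a * |u|)) (ν : Measure ℝ) ∧
      ∫ u, Real.exp (a * |u|) ∂(ν : Measure ℝ) ≤ Real.exp (a ^ 2 / 4) * C₁ := fun a =>
    integrable_of_tendsto_of_integral_le hlim (by fun_prop) (fun u => (Real.exp_pos _).le)
      (hks a) (hkD a)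
  -- the Laplace transforms
  set F : ℕ → ℂ → ℂ := fun k z => ∫ u, Complex.exp (z * u) ∂(μs k : Measure ℝ) with hF
  set f : ℂ → ℂ := fun z => ∫ u, Complex.exp (z * u) ∂(ν : Measure ℝ) with hf
  -- (3) pointwise convergence
  have hpt : ∀ z, Tendsto (fun k => F k z) atTop (𝓝 (f z)) := fun z =>
    tendsto_integral_cexp_of_tendsto hlim (hks _) (hkD _) (hν _).1 (hν _).2 le_rfl
  -- (4) equi-Lipschitz on discs, hence locally uniform convergence
  have hlip : ∀ R : ℝ, ∃ L : ℝ≥0, ∀ k, LipschitzOnWith L (F k) (closedBall 0 R) := by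
    intro R
    refine ⟨(Real.exp ((R + 1) ^ 2 / 4) * C₁).toNNReal, fun k => ?_⟩
    refine LipschitzOnWith.of_dist_le_mul fun z hz z' hz' => ?_
    have hzR : ‖z‖ ≤ R + 1 := by linarith [mem_closedBall_zero_iff.1 hz]
    have hz'R : ‖z'‖ ≤ R + 1 := by linarith [mem_closedBall_zero_iff.1 hz']
    rw [dist_eq_norm, dist_eq_norm]
    change ‖(∫ u, Complex.exp (z * u) ∂(μs k : Measure ℝ)) -
      ∫ u, Complex.exp (z' * u) ∂(μs k : Measure ℝ)‖ ≤ _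
    rw [← integral_sub (integrable_cexp_mul_of_norm_le (hks _ k) hzR)
      (integrable_cexp_mul_of_norm_le (hks _ k) hz'R)]
    calc ‖∫ u, Complex.exp (z * u) - Complex.exp (z' * u) ∂(μs k : Measure ℝ)‖
        ≤ ∫ u, Real.exp ((R + 1) * |u|) * ‖z - z'‖ ∂(μs k : Measure ℝ) :=
          norm_integral_le_of_norm_le ((hks _ k).mul_const _)
            (Eventually.of_forall fun u => norm_cexp_sub_cexp_le hz hz' u)
      _ = (∫ u, Real.exp ((R + 1) * |u|) ∂(μs k : Measure ℝ)) * ‖z - z'‖ :=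
          integral_mul_const _ _
      _ ≤ Real.exp ((R + 1) ^ 2 / 4) * C₁ * ‖z - z'‖ := by gcongr; exact hkD _ k
      _ ≤ ((Real.exp ((R + 1) ^ 2 / 4) * C₁).toNNReal : ℝ) * ‖z - z'‖ := by
          gcongr; exact Real.le_coe_toNNReal _
  have hloc : TendstoLocallyUniformly F f atTop :=
    tendstoLocallyUniformly_of_lipschitzOnWith hpt hlip
  -- (5) the approximants are entire and zero-free off the imaginary axis
  have hdiff : ∀ k, Differentiable ℂ (F k) := fun k =>
    differentiable_integral_cexp fun t => hint k (by fun_prop)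
  have hne : ∀ k z, z.re ≠ 0 → F k z ≠ 0 := by
    intro k z hz
    change (∫ u, Complex.exp (z * u) ∂(isingMagnetizationLaw (n k) (J k) (w k) : Measure ℝ)) ≠ 0
    rw [integral_exp_isingMagnetizationLaw]
    exact div_ne_zero (lee_yang_ising_holds _ _ _ (hJ k) (hw k) z hz)
      (Complex.ofReal_ne_zero.2 (isingPairPartition_pos _).ne')
  -- (6) the limit transform is positive at real points
  have hreal : ∀ x : ℝ, f x ≠ 0 := by
    intro x
    change complexMGF id (ν : Measure ℝ) x ≠ 0
    rw [complexMGF_ofReal]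
    exact_mod_cast (mgf_pos (integrable_exp_mul_of_abs_le (hν |x|).1 le_rfl)).ne'
  -- (7) Hurwitz on an open preconnected `U` off the axis containing a real point
  have key : ∀ U : Set ℂ, IsOpen U → IsPreconnected U → (∀ z ∈ U, z.re ≠ 0) →
      ∀ x : ℝ, (x : ℂ) ∈ U → ∀ z ∈ U, f z ≠ 0 := by
    intro U hUo hUc hUsub x hx
    rcases Complex.hurwitz_eqOn_zero_or_forall_ne_zero hUo hUc
        (Eventually.of_forall fun k => (hdiff k).differentiableOn)
        ((tendstoLocallyUniformlyOn_univ.2 hloc).mono (subset_univ U))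
        (Eventually.of_forall fun k z hz => hne k z (hUsub z hz)).frequently with h | h
    · exact fun z _ => absurd (h hx) (hreal x)
    · exact h
  refine HasLeeYangProperty.of_forall fun z hz => ?_
  rcases lt_or_gt_of_ne hz with hlt | hgt
  · exact key {z | z.re < 0} (isOpen_lt Complex.continuous_re continuous_const)
      (convex_halfSpace_re_lt 0).isPreconnected (fun z hz => ne_of_lt hz) (-1)
      (show ((-1 : ℝ) : ℂ) ∈ {z : ℂ | z.re < 0} by simp) z hlt
  · exact key {z | 0 < z.re} (isOpen_lt continuous_const Complex.continuous_re)
      (convex_halfSpace_re_gt 0).isPreconnected (fun z hz => ne_of_gt hz) 1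
      (show ((1 : ℝ) : ℂ) ∈ {z : ℂ | 0 < z.re} by simp) z hgt

end Literature.Probability.LatticeModels

end
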